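import Mathlib.Analysis.Fourier.ZMod
import Literature.Analysis.Fourier.DiscreteCantorFUPProofs

/-!
# Crux `DlogGraphFlat` (stmt-QuantumAdvantage-10732), line `Sketch_holder_energy` — stub B2:
# the fourth moment of the DFT is `N` times the additive energy (`stub_heFourthMoment`)

For a real-valued `s : ℤ/N → ℝ`, the classical identity
`∑_k ‖𝓕 s (k)‖⁴ = N · ∑_{x₁, x₂, x₃} s(x₁) s(x₂) s(x₃) s(x₁ + x₂ − x₃)`.

Proof (the Plancherel template `Literature.Analysis.Fourier.sum_norm_sq_dft`, squared): expand
`‖𝓕 s (k)‖² = 𝓕 s (k) · conj (𝓕 s (k)) = ∑_{j, j'} s(j) s(j') χ((j' − j) k)`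
(`heFourthMoment_norm_sq_dft`; `s` is real, so `conj s = s`), multiply two copies to get a
fourfold sum with phase `χ((j₁' + j₂' − j₁ − j₂) k)` (`heFourthMoment_norm_four_dft`), sum over
`k` first and collapse with the orthogonality relation `∑_k χ(t k) = N · [t = 0]`
(`Literature.Analysis.Fourier.sum_stdAddChar_mul`): the surviving quadruples are
`j₂' = j₁ + j₂ − j₁'`.
-/

set_option linter.dupNamespace false -- D-0017: single-problem summit ⇒ `QuantumAdvantage.QuantumAdvantage` by design

namespace Summit.QuantumAdvantage.QuantumAdvantage.Theorems.SymplecticPurity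

open scoped ZMod
open Finset Complex Literature.Analysis.Fourier

/-- `‖𝓕 s (k)‖² = ∑_{j, j'} s(j) s(j') χ((j' − j) k)` for real `s` (as a complex identity). -/
theorem heFourthMoment_norm_sq_dft {N : ℕ} [NeZero N] (s : ZMod N → ℝ) (k : ZMod N) :
    ((‖𝓕 (fun x => (s x : ℂ)) k‖ : ℝ) : ℂ) ^ 2 =
      ∑ j : ZMod N, ∑ j' : ZMod N, (s j : ℂ) * (s j' : ℂ) * ZMod.stdAddChar ((j' - j) * k) := by
  rw [← Complex.mul_conj', ZMod.dft_apply, map_sum, Finset.sum_mul_sum]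
  refine Finset.sum_congr rfl fun j _ => Finset.sum_congr rfl fun j' _ => ?_
  simp only [smul_eq_mul, map_mul, conj_stdAddChar, neg_neg, Complex.conj_ofReal]
  have h : ZMod.stdAddChar (-(j * k)) * ZMod.stdAddChar (j' * k)
      = (ZMod.stdAddChar ((j' - j) * k) : ℂ) := by
    rw [← AddChar.map_add_eq_mul]; congr 1; ring
  calc ZMod.stdAddChar (-(j * k)) * (s j : ℂ) * (ZMod.stdAddChar (j' * k) * (s j' : ℂ))
      = (s j : ℂ) * (s j' : ℂ) * (ZMod.stdAddChar (-(j * k)) * ZMod.stdAddChar (j' * k)) := by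
        ring
    _ = _ := by rw [h]

/-- `‖𝓕 s (k)‖⁴ = ∑_{j₁, j₂, j₁', j₂'} s(j₁) s(j₂) s(j₁') s(j₂') χ((j₁' + j₂' − j₁ − j₂) k)` for
real `s` (as a complex identity): the square of `heFourthMoment_norm_sq_dft`. -/
theorem heFourthMoment_norm_four_dft {N : ℕ} [NeZero N] (s : ZMod N → ℝ) (k : ZMod N) :
    ((‖𝓕 (fun x => (s x : ℂ)) k‖ : ℝ) : ℂ) ^ 4 =
      ∑ j₁ : ZMod N, ∑ j₂ : ZMod N, ∑ j₁' : ZMod N, ∑ j₂' : ZMod N,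
        (s j₁ : ℂ) * (s j₂ : ℂ) * (s j₁' : ℂ) * (s j₂' : ℂ) *
          ZMod.stdAddChar ((j₁' + j₂' - j₁ - j₂) * k) := by
  have h4 : ((‖𝓕 (fun x => (s x : ℂ)) k‖ : ℝ) : ℂ) ^ 4 =
      ((‖𝓕 (fun x => (s x : ℂ)) k‖ : ℝ) : ℂ) ^ 2 * ((‖𝓕 (fun x => (s x : ℂ)) k‖ : ℝ) : ℂ) ^ 2 := by
    ring
  rw [h4, heFourthMoment_norm_sq_dft, Finset.sum_mul_sum]
  refine Finset.sum_congr rfl fun j₁ _ => Finset.sum_congr rfl fun j₂ _ => ?_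
  rw [Finset.sum_mul_sum]
  refine Finset.sum_congr rfl fun j₁' _ => Finset.sum_congr rfl fun j₂' _ => ?_
  have h : (ZMod.stdAddChar ((j₁' - j₁) * k) : ℂ) * ZMod.stdAddChar ((j₂' - j₂) * k)
      = ZMod.stdAddChar ((j₁' + j₂' - j₁ - j₂) * k) := by
    rw [← AddChar.map_add_eq_mul]; congr 1; ring
  rw [← h]; ring

/-- **Stub B2: fourth moment of the DFT = `N` × additive energy.** For real `s : ℤ/N → ℝ`,
`∑_k ‖𝓕 s (k)‖⁴ = N · ∑_{x₁, x₂, x₃} s(x₁) s(x₂) s(x₃) s(x₁ + x₂ − x₃)`. -/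
theorem stub_heFourthMoment : ∀ (N : ℕ) [NeZero N] (s : ZMod N → ℝ),
    ∑ k : ZMod N, ‖ZMod.dft (fun x => (s x : ℂ)) k‖ ^ 4 =
      (N : ℝ) * ∑ x₁ : ZMod N, ∑ x₂ : ZMod N, ∑ x₃ : ZMod N,
        s x₁ * s x₂ * s x₃ * s (x₁ + x₂ - x₃) := by
  intro N _ s
  apply Complex.ofReal_injective
  push_cast
  simp_rw [heFourthMoment_norm_four_dft]
  calc ∑ k : ZMod N, ∑ j₁ : ZMod N, ∑ j₂ : ZMod N, ∑ j₁' : ZMod N, ∑ j₂' : ZMod N,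
        (s j₁ : ℂ) * (s j₂ : ℂ) * (s j₁' : ℂ) * (s j₂' : ℂ) *
          ZMod.stdAddChar ((j₁' + j₂' - j₁ - j₂) * k)
      = ∑ j₁ : ZMod N, ∑ j₂ : ZMod N, ∑ j₁' : ZMod N, ∑ j₂' : ZMod N,
          (s j₁ : ℂ) * (s j₂ : ℂ) * (s j₁' : ℂ) * (s j₂' : ℂ) *
            ∑ k : ZMod N, (ZMod.stdAddChar ((j₁' + j₂' - j₁ - j₂) * k) : ℂ) := by
        rw [Finset.sum_comm]
        refine Finset.sum_congr rfl fun j₁ _ => ?_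
        rw [Finset.sum_comm]
        refine Finset.sum_congr rfl fun j₂ _ => ?_
        rw [Finset.sum_comm]
        refine Finset.sum_congr rfl fun j₁' _ => ?_
        rw [Finset.sum_comm]
        refine Finset.sum_congr rfl fun j₂' _ => ?_
        rw [Finset.mul_sum]
    _ = ∑ j₁ : ZMod N, ∑ j₂ : ZMod N, ∑ j₁' : ZMod N,
          (s j₁ : ℂ) * (s j₂ : ℂ) * (s j₁' : ℂ) * (s (j₁ + j₂ - j₁') : ℂ) * (N : ℂ) := by
        refine Finset.sum_congr rfl fun j₁ _ => Finset.sum_congr rfl fun j₂ _ =>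
          Finset.sum_congr rfl fun j₁' _ => ?_
        have hiff : ∀ j₂' : ZMod N, j₁' + j₂' - j₁ - j₂ = 0 ↔ j₁ + j₂ - j₁' = j₂' := by
          intro j₂'
          constructor
          · intro h; linear_combination -h
          · intro h; linear_combination -h
        simp_rw [sum_stdAddChar_mul, hiff, mul_ite, mul_zero]
        rw [Finset.sum_ite_eq]
        simp
    _ = (N : ℂ) * ∑ x₁ : ZMod N, ∑ x₂ : ZMod N, ∑ x₃ : ZMod N,
          (s x₁ : ℂ) * (s x₂ : ℂ) * (s x₃ : ℂ) * (s (x₁ + x₂ - x₃) : ℂ) := by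
        rw [Finset.mul_sum]
        refine Finset.sum_congr rfl fun x₁ _ => ?_
        rw [Finset.mul_sum]
        refine Finset.sum_congr rfl fun x₂ _ => ?_
        rw [Finset.mul_sum]
        refine Finset.sum_congr rfl fun x₃ _ => ?_
        ring

end Summit.QuantumAdvantage.QuantumAdvantage.Theorems.SymplecticPurity
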